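import Literature.AlgebraicTopology.SingularHomology.RelativeHurewiczIsomorphism
import Literature.AlgebraicTopology.SingularHomology.RelativeHurewiczIsZeroProofs
import Literature.AlgebraicTopology.Homotopy.RelativeHomotopyGroupStructure
import HarnessLib

/-!
# `πₙ₊₁(A) ≃ Hₙ₊₂(X, A; ℤ)` when `X` kills `πₙ₊₁(A)`: the homological reading of the next homotopy group

Topic `Literature/AlgebraicTopology/SingularHomology`. The step by which Serre's method reads off
a homotopy group as a homology group (J.-P. Serre, *Homologie singulière des espaces fibrés*,
Ann. of Math. 54 (1951), Ch. IV §3; R. Mosher–M. Tangora, *Cohomology Operations* (1968), Ch. 12;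
A. Hatcher, *Algebraic Topology* (2002), §4.2 Thm. 4.32 with the exact sequence Thm. 4.3 and
§4.3 p. 410 (Postnikov towers)): if `A ⊆ X` are simply connected, the pair `(X, A)` is
`(N+1)`-connected and `π_{N+2}(X) = π_{N+1}(X) = 0` (e.g. `X` a Postnikov section `P_N` of `A`),
then the boundary `∂ : π_{N+2}(X, A) → π_{N+1}(A)` is a bijection and the relative Hurewicz
theorem gives `π_{N+2}(X, A) ≃ H_{N+2}(X, A; ℤ)`, while `Hᵢ(X, A; ℤ) = 0` for `i ≤ N + 1`:

* `RelativeHurewiczBoundary.bijective_boundary` — `∂ : π_{N+2}(X, A, a) → π_{N+1}(A, a)` is a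
  bijection when `π_{N+2}(X, a)` and `π_{N+1}(X, a)` are trivial;
* `RelativeHurewiczBoundary.isZero_relativeSingularHomology` — `Hᵢ(X, A; ℤ) = 0`, `i ≤ N + 1`;
* `RelativeHurewiczBoundary.nonempty_equiv` — **`π_{N+1}(A, a) ≃ H_{N+2}(X, A; ℤ)`**.

The tree's relative Hurewicz theorem (`relativeHurewicz_equiv_holds`, `…_isZero_holds`, proved)
records a bijection of sets, and so does this file. Everything is proved; no named facts.

## References

* J.-P. Serre, *Homologie singulière des espaces fibrés. Applications*, Ann. of Math. (2) 54
  (1951), 425–505, Ch. IV §3. [Serre1951]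
* A. Hatcher, *Algebraic Topology*, CUP (2002), Thm. 4.3, Thm. 4.32, §4.3 p. 410. [HatcherAT2002]
-/

noncomputable section

open CategoryTheory CategoryTheory.Limits
open scoped Topology Topology.Homotopy
open Literature.AlgebraicTopology.Homotopy

namespace Literature.AlgebraicTopology.SingularHomology

universe u

namespace RelativeHurewiczBoundary

variable {X : Type u} [TopologicalSpace X] {A : Set X} {a : A}

/-- **`∂ : π_{N+2}(X, A, a) → π_{N+1}(A, a)` is a bijection when `π_{N+2}(X, a) = π_{N+1}(X, a) = 0`**
(exactness of the homotopy sequence of the pair, Hatcher Thm. 4.3: `π_{N+2}(X) → π_{N+2}(X, A) →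
π_{N+1}(A) → π_{N+1}(X)`). [cite: HatcherAT2002, Thm. 4.3] -/
theorem bijective_boundary (N : ℕ)
    (h₂ : Subsingleton (HomotopyGroup (Fin (N + 2)) X (a : X)))
    (h₁ : Subsingleton (HomotopyGroup { j : Fin (N + 2) // j ≠ 0 } X (a : X))) :
    Function.Bijective (RelHomotopyGroup.boundary :
      RelHomotopyGroup (0 : Fin (N + 2)) X A a → HomotopyGroup { j : Fin (N + 2) // j ≠ 0 } A a) := by
  constructor
  · -- injectivity: `∂` is a homomorphism with trivial kernel (`ker ∂ = im j_*`, `π_{N+2}(X) = 0`)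
    have hinj : Function.Injective (RelHomotopyGroup.boundaryHom (0 : Fin (N + 2)) :
        RelHomotopyGroup (0 : Fin (N + 2)) X A a →* HomotopyGroup { j : Fin (N + 2) // j ≠ 0 } A a) := by
      refine (injective_iff_map_eq_one _).2 fun c hc => ?_
      have hc' : RelHomotopyGroup.boundary c = (⟦GenLoop.const⟧ : HomotopyGroup { j : Fin (N + 2) // j ≠ 0 } A a) := by
        rw [← RelHomotopyGroup.coe_boundaryHom, hc, HomotopyGroup.one_def]
      obtain ⟨b, rfl⟩ := RelHomotopyGroup.exists_ofAbsolute_eq c hc'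
      rw [Subsingleton.elim (h := h₂) b ⟦GenLoop.const⟧, RelHomotopyGroup.ofAbsolute_const,
        RelHomotopyGroup.one_eq_default]
    exact hinj
  · -- surjectivity: `im ∂ = ker i_*` and `π_{N+1}(X) = 0`
    intro b
    exact RelHomotopyGroup.exists_boundary_eq b (Subsingleton.elim (h := h₁) _ _)

/-- **`Hᵢ(X, A; ℤ) = 0` for `i ≤ N + 1`** when `A ⊆ X` are simply connected and `(X, A)` is
`(N+1)`-connected (the vanishing clause of the relative Hurewicz theorem). [cite: HatcherAT2002, Thm. 4.32] -/
theorem isZero_relativeSingularHomology [SimplyConnectedSpace X] [SimplyConnectedSpace A] (N : ℕ)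
    (hconn : ∀ (k : ℕ) [NeZero k], 2 ≤ k → k ≤ N + 1 → ∀ a' : A, Subsingleton (RelHomotopyGroup.Pi k X A a'))
    {i : ℕ} (hi : i ≤ N + 1) : IsZero (relativeSingularHomology ℤ ℤ X A i) :=
  relativeHurewicz_isZero_holds X A (N + 2) (by omega) (fun k _ hk2 hkN a' => hconn k hk2 (by omega) a') i (by omega)

/-- **`π_{N+1}(A, a) ≃ H_{N+2}(X, A; ℤ)`** when `A ⊆ X` are simply connected, `(X, A)` is
`(N+1)`-connected and `π_{N+2}(X, a) = π_{N+1}(X, a) = 0`: the boundary bijection composed with the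
relative Hurewicz bijection. [cite: Serre1951, Ch. IV §3; HatcherAT2002, Thm. 4.32 and §4.3 p. 410] -/
theorem nonempty_equiv [SimplyConnectedSpace X] [SimplyConnectedSpace A] (N : ℕ) (a : A)
    (hconn : ∀ (k : ℕ) [NeZero k], 2 ≤ k → k ≤ N + 1 → ∀ a' : A, Subsingleton (RelHomotopyGroup.Pi k X A a'))
    (h₂ : Subsingleton (HomotopyGroup (Fin (N + 2)) X (a : X)))
    (h₁ : Subsingleton (HomotopyGroup { j : Fin (N + 2) // j ≠ 0 } X (a : X))) :
    Nonempty (HomotopyGroup { j : Fin (N + 2) // j ≠ 0 } A a ≃ relativeSingularHomology ℤ ℤ X A (N + 2)) := by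
  obtain ⟨e⟩ := relativeHurewicz_equiv_holds X A (N + 2) (by omega)
    (fun k _ hk2 hkN a' => hconn k hk2 (by omega) a') a
  exact ⟨(Equiv.ofBijective _ (bijective_boundary N h₂ h₁)).symm.trans e⟩

end RelativeHurewiczBoundary

end Literature.AlgebraicTopology.SingularHomology

end
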